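import Summits.AtomisticToContinuum.BoseEinsteinCondensation.Theses.BECConjugateDomination
import Summits.AtomisticToContinuum.BoseEinsteinCondensation.Theses.BECWallDressingTransfer
import Summits.AtomisticToContinuum.BoseEinsteinCondensation.Theorems.BECPeriodicReductionBoundaryTransferWeakResidual
import Summits.AtomisticToContinuum.BoseEinsteinCondensation.Theorems.BECSwapNoCatastropheSwapToZeroModeStability
import Literature.MathematicalPhysics.QuantumManyBody.CondensateOccupationStability

/-!
# Crux `BoundaryTransferWeak` (stmt-AtomisticToContinuum-0827) — birth skeleton (BC3), line `birth-slackexchange`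

Route of record: `route-AtomisticToContinuum-BECConjugateDomination` (the crux is shared verbatim by
the `BoundaryTransferWeak` decls of ~40 BEC routes; home route `BECPeriodicReduction`). The crux,
per potential `v`: torus BEC of the periodic near-minimisers at all small densities
(`A(v)`, i.e. `∃ ρ₀ ∀ ρ < ρ₀ ∃ c > 0, TorusBECAt v ρ c`) ⟹ Dirichlet ground-state BEC at all small
densities (`∃ ρ₀ ∀ ρ < ρ₀, HasGroundStateBEC v ρ`).

## What is already landed (used below, not re-stubbed)

* `RewardPaysTheWall.stub_transfer` (p85115 over p74246–p76612) + `exists_density_cap_tendsto_e0` +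
  `eventually_exists_condensed_of_rewardedUpperBound`, packaged per potential as
  `RewardPaysTheWall.boundaryTransferAt_of_condensedToBECAt` (p96138): everything `A(v)` sends across
  the wall is CONDENSED COMPETITORS in the Dirichlet cube of side `L_N(ρ)` —
  `∀ θ > 0, ∀ᶠ N, ∃ Ψ : TrialState N L_N, ⟨Ψ,HΨ⟩ ≤ E₀^D + θN ∧ n_flat(Ψ) ≥ (c - θ)N`
  (`n_flat` = occupation of `boxConstantMode L_N`), and the crux at `v` follows from the residual
  "condensed competitors ⟹ `HasGroundStateBEC v ρ`" at `v`.
* `Theorems.SwapToZeroMode.occupation_rpow_half_le_add` (landed, route BECSwapNoCatastrophe):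
  `√occ_φ` is a seminorm dominated by `√N ‖·‖₂` (LSSY 2005 §1.2 (1.17)).

## The cut (two registered stubs, both load-bearing)

The residual bridges two quantifier gaps at once: from SOME condensed state at slack `θN`
(`N ≥ N₀(θ)`) to ALL `δ`-near-minimisers at some `δ > 0`. We cut it at the natural seam
EXISTENCE / UNIQUENESS:

* `stub_slackExchange : SlackExchange` (NEW; the hard stub, open-problem rank; statement = the named
  `def SlackExchange`): condensed competitors at every
  extensive slack `θN` ⟹ for some `c' > 0`, eventually in `N`, flat-condensed trial states
  (`n_flat ≥ c'N`) exist at EVERY slack `ε > 0` above `E₀^D(N, L_N)`. This is the `θ ↔ N`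
  interchange in EXISTENTIAL, flat-mode form — weaker than the planner's `Unrewarding` of the dead
  line `reward-pays-the-wall` (no reward, no "all near-minimisers", constant allowed to drop:
  `c' = c` is false already at `v = 0`, `Negative/RewardedFreeGasAnchors.not_unrewardingSameConstant`),
  and exactly the hypothesis shape consumed by the landed `TorusInTheBox.stub_nearMinimiserTransfer`
  / produced by `TorusInTheBox.stub_condensedFromGroundState` (so ANY proof that the Dirichlet ground
  state is flat-condensed closes it, with or without the competitors). Disproof used:
  `Negative/SoftUnrewardingSchema.not_softUnrewarding_twoState` — a proof must use the Bose-gas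
  objects (`TrialState`, `energy v`, `boxConstantMode`), not the affine-in-slack bookkeeping alone;
  `Disproof.lean` §2 (δ-erasure) and §4 (mode-free windows are `O(N/L²)`) are respected: the stub
  asks for ONE state per slack, never for all states in a window.
* `stub_groundStateRigidity` = `Theses.BECWallDressingTransfer.GroundStateRigidity`, the shared item
  stmt-AtomisticToContinuum-9072 VERBATIM (by name, so closing 9072 closes this stub): at small
  density and large `N`, any two `δ`-near-minimisers of the Dirichlet energy are `η`-close in `L²`
  up to a phase (compact resolvent, unique positive ground state, gap at fixed `N`; open for hard
  cores, cf. the `BECCutLineWeakDisorderGroundStateRigidity*` files for the locally bounded class).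

## The composition (sorry-free)

`flatModeBEC_of_everySlack_of_rigidity` (every-slack flat-condensed states + rigidity ⟹ every
`δ`-near-minimiser has `n_flat ≥ (c'/4)N`, by the seminorm bound with `η = c'/16`) ⟹
`condensedToBECAt_of_slackExchange_of_rigidity` (the residual at `v`, via `le_condensateNumber` and
`occupation_le_maxOccupation` for the normalised flat mode) ⟹ `boundaryTransferWeak_from`
(stub statements → crux per potential, via `boundaryTransferAt_of_condensedToBECAt`) ⟹
`BoundaryTransferWeak_of` (= `boundaryTransferWeak_from stub_slackExchange stub_groundStateRigidity`;
conclusion = the route decl `Theses.BECConjugateDomination.BoundaryTransferWeak` BY NAME; direct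
`sorry` only inside the two `stub_*`).

References: LSSY 2005 §1.2 (1.17)–(1.19), Ch. 2 after (2.2)/(2.8), App. D (D.15)–(D.19);
Griffiths 1966 §II; Basti–Cenatiempo–Schlein 2021 App. A; Reed–Simon IV XIII.12/XIII.47.
-/

noncomputable section

open MeasureTheory Filter
open scoped ENNReal NNReal

namespace Summit.AtomisticToContinuum.BoseEinsteinCondensation.Cruxes.BoundaryTransferWeak.BirthSlackExchange

open Literature.MathematicalPhysics.QuantumManyBody.BoseGas

/-! ## Registered stubs -/

/-- **Stub 1 — slack exchange (the hard stub).** For every repulsive finite-range `v` there is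
`ρ₃ > 0` such that for `0 < ρ < ρ₃` and `0 < c ≤ 1`: if for every `θ > 0`, eventually in `N`, some
Dirichlet trial state in the cube of side `L_N(ρ)` within `θN` of `E₀^D(N, L_N)` has flat-mode
occupation `≥ (c - θ)N`, then for some `c' > 0`, eventually in `N`, flat-condensed trial states
(`n_flat ≥ c'N`) exist at EVERY slack `ε > 0` above `E₀^D(N, L_N)`. Plausible because its conclusion
is what flat-mode BEC of the Dirichlet ground state gives through `stub_condensedFromGroundState`
(Bogoliubov/GP picture: the Dirichlet condensate wave function is flat off a healing-length boundary
layer, flat fraction `→ 1`; `v = 0`: `(8/π²)³`); hard because it is the `θ ↔ N` interchange of LSSY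
2005 App. D (open converse of (D.17)) in existential form. Size XL. -/
def SlackExchange : Prop :=
    ∀ v : ℝ → ℝ≥0∞, IsRepulsiveFiniteRange v → ∃ ρ₃ : ℝ, 0 < ρ₃ ∧ ∀ ρ : ℝ, 0 < ρ → ρ < ρ₃ →
      ∀ c : ℝ, 0 < c → c ≤ 1 →
        (∀ θ : ℝ, 0 < θ → ∀ᶠ N : ℕ in atTop, ∃ Ψ : TrialState N (sideLength ρ N),
          energy v Ψ ≤ groundStateEnergy v N (sideLength ρ N) + ENNReal.ofReal (θ * N) ∧
            ENNReal.ofReal ((c - θ) * N) ≤ occupation N (boxConstantMode (sideLength ρ N)) Ψ.ψ) →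
        ∃ c' : ℝ, 0 < c' ∧ ∀ᶠ N : ℕ in atTop, ∀ ε : ℝ≥0∞, 0 < ε →
          ∃ Φ : TrialState N (sideLength ρ N),
            energy v Φ ≤ groundStateEnergy v N (sideLength ρ N) + ε ∧
              ENNReal.ofReal (c' * N) ≤ occupation N (boxConstantMode (sideLength ρ N)) Φ.ψ

/-- **Registered stub 1**: the slack-exchange statement `SlackExchange` (docstring above). -/
theorem stub_slackExchange : SlackExchange := by
  sorry

/-- **Stub 2 — ground-state rigidity** (the shared item stmt-AtomisticToContinuum-9072, by name):
for every repulsive finite-range `v`, at small density and large `N`, for every `η > 0` there is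
`δ > 0` such that any two `δ`-near-minimisers `Ψ, Φ` of the Dirichlet energy in the cube of side
`L_N(ρ)` satisfy `∫ |Ψ - cΦ|² ≤ η` for some unit complex `c`. Size M (locally bounded `v`: compact
resolvent + Perron–Frobenius; hard cores: connectedness of the admissible region at low density). -/
theorem stub_groundStateRigidity : Theses.BECWallDressingTransfer.GroundStateRigidity := by
  sorry

/-! ## Glue (proved) -/

/-- Bookkeeping: if `√(cN) ≤ b + √(cN)/4` in `ℝ≥0∞` then `(c/4) N ≤ b²`. [folklore] -/
theorem ofReal_quarter_mul_le_sq {c : ℝ} (hc : 0 ≤ c) (N : ℕ) {b : ℝ≥0∞}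
    (h : ENNReal.ofReal (Real.sqrt (c * N)) ≤ b + ENNReal.ofReal (Real.sqrt (c * N) / 4)) :
    ENNReal.ofReal (c / 4 * N) ≤ b ^ 2 := by
  have hcN : 0 ≤ c * N := by positivity
  have h1 : ENNReal.ofReal (3 / 4 * Real.sqrt (c * N)) ≤ b := by
    rw [show 3 / 4 * Real.sqrt (c * N) = Real.sqrt (c * N) - Real.sqrt (c * N) / 4 by ring,
      ENNReal.ofReal_sub _ (by positivity)]
    exact tsub_le_iff_right.2 h
  calc ENNReal.ofReal (c / 4 * N) ≤ ENNReal.ofReal ((3 / 4 * Real.sqrt (c * N)) ^ 2) := by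
        refine ENNReal.ofReal_le_ofReal ?_
        rw [mul_pow, Real.sq_sqrt hcN]
        nlinarith
    _ = ENNReal.ofReal (3 / 4 * Real.sqrt (c * N)) ^ 2 := by
        rw [ENNReal.ofReal_pow (by positivity)]
    _ ≤ b ^ 2 := by gcongr

/-- **Existence + rigidity ⟹ flat-mode condensation of ALL near-minimisers** at one `(v, ρ)`:
if eventually in `N` flat-condensed trial states (`n_flat ≥ c'N`) exist at every slack, and
near-minimisers are `L²`-rigid up to a phase, then eventually in `N` there is `δ > 0` such that every
`δ`-near-minimiser has `n_flat ≥ (c'/4)N` (seminorm bound for `√n_flat` with `η = c'/16`).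
[folklore] -/
theorem flatModeBEC_of_everySlack_of_rigidity {v : ℝ → ℝ≥0∞} {ρ c' : ℝ} (hρ : 0 < ρ)
    (hc' : 0 < c')
    (hS : ∀ᶠ N : ℕ in atTop, ∀ ε : ℝ≥0∞, 0 < ε → ∃ Φ : TrialState N (sideLength ρ N),
      energy v Φ ≤ groundStateEnergy v N (sideLength ρ N) + ε ∧
        ENNReal.ofReal (c' * N) ≤ occupation N (boxConstantMode (sideLength ρ N)) Φ.ψ)
    (hR : ∀ᶠ N : ℕ in atTop, ∀ η : ℝ, 0 < η → ∃ δ : ℝ≥0∞, 0 < δ ∧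
      ∀ Ψ Φ : TrialState N (sideLength ρ N),
        energy v Ψ ≤ groundStateEnergy v N (sideLength ρ N) + δ →
          energy v Φ ≤ groundStateEnergy v N (sideLength ρ N) + δ →
            ∃ c : ℂ, ‖c‖ = 1 ∧ ∫⁻ X, (‖Ψ.ψ X - c * Φ.ψ X‖₊ : ℝ≥0∞) ^ 2 ≤ ENNReal.ofReal η) :
    ∀ᶠ N : ℕ in atTop, ∃ δ : ℝ≥0∞, 0 < δ ∧ ∀ Ψ : TrialState N (sideLength ρ N),
      energy v Ψ ≤ groundStateEnergy v N (sideLength ρ N) + δ →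
        ENNReal.ofReal (c' / 4 * N) ≤ occupation N (boxConstantMode (sideLength ρ N)) Ψ.ψ := by
  filter_upwards [hS, hR, eventually_gt_atTop 0] with N hSN hRN hNpos
  obtain ⟨n, rfl⟩ : ∃ n, N = n + 1 := ⟨N - 1, (Nat.succ_pred_eq_of_pos hNpos).symm⟩
  set L : ℝ := sideLength ρ (n + 1) with hLdef
  have hL : 0 < L := by
    rw [hLdef]
    unfold sideLength
    exact Real.rpow_pos_of_pos (div_pos (Nat.cast_pos.mpr hNpos) hρ) _
  -- `δ` from rigidity at `η = c'/16`, a flat-condensed competitor `Φ` at slack `δ`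
  obtain ⟨δ, hδ, hrig⟩ := hRN (c' / 16) (by positivity)
  obtain ⟨Φ, hΦE, hΦocc⟩ := hSN δ hδ
  refine ⟨δ, hδ, fun Ψ hΨE => ?_⟩
  obtain ⟨c₁, hc₁, hdist⟩ := hrig Φ Ψ hΦE hΨE
  -- the flat mode is a.e.-strongly measurable and `L²`-normalised
  have hu : AEStronglyMeasurable (boxConstantMode L) volume :=
    _root_.AtomisticToContinuum.BECInfraredBound.aestronglyMeasurable_constMode L
  have hu1 : ∫⁻ x, (‖boxConstantMode L x‖₊ : ℝ≥0∞) ^ 2 = 1 :=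
    _root_.AtomisticToContinuum.BECInfraredBound.lintegral_constMode_sq hL
  -- seminorm bound: `√occ(Φ) ≤ √occ(Ψ) + √N ‖Φ - c₁Ψ‖₂`
  have hkey := Theorems.SwapToZeroMode.occupation_rpow_half_le_add (n := n) hu hu1
    Φ.contDiff.continuous.measurable Ψ.contDiff.continuous.measurable hc₁
  have hsq : ∀ x : ℝ≥0∞, (x ^ (1 / 2 : ℝ)) ^ 2 = x := fun x => by
    rw [← ENNReal.rpow_two, ← ENNReal.rpow_mul]
    norm_num
  have hcN : 0 ≤ c' * ((n + 1 : ℕ) : ℝ) := by positivity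
  have h1 : ENNReal.ofReal (Real.sqrt (c' * ((n + 1 : ℕ) : ℝ))) ≤
      occupation (n + 1) (boxConstantMode L) Φ.ψ ^ (1 / 2 : ℝ) := by
    rw [← ofReal_rpow_half_eq_sqrt hcN]
    exact ENNReal.rpow_le_rpow hΦocc (by norm_num)
  have h2 : ((n + 1 : ℕ) : ℝ≥0∞) ^ (1 / 2 : ℝ) *
        (∫⁻ X, (‖Φ.ψ X - c₁ * Ψ.ψ X‖₊ : ℝ≥0∞) ^ 2) ^ (1 / 2 : ℝ) ≤
      ENNReal.ofReal (Real.sqrt (c' * ((n + 1 : ℕ) : ℝ)) / 4) := by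
    calc ((n + 1 : ℕ) : ℝ≥0∞) ^ (1 / 2 : ℝ) *
          (∫⁻ X, (‖Φ.ψ X - c₁ * Ψ.ψ X‖₊ : ℝ≥0∞) ^ 2) ^ (1 / 2 : ℝ)
        ≤ ((n + 1 : ℕ) : ℝ≥0∞) ^ (1 / 2 : ℝ) * (ENNReal.ofReal (c' / 16)) ^ (1 / 2 : ℝ) := by
          gcongr
      _ = (((n + 1 : ℕ) : ℝ≥0∞) * ENNReal.ofReal (c' / 16)) ^ (1 / 2 : ℝ) := by
          rw [ENNReal.mul_rpow_of_nonneg _ _ (by norm_num : (0 : ℝ) ≤ 1 / 2)]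
      _ = ENNReal.ofReal (Real.sqrt (c' * ((n + 1 : ℕ) : ℝ)) / 4) := by
          rw [← ENNReal.ofReal_natCast, ← ENNReal.ofReal_mul (Nat.cast_nonneg _),
            ofReal_rpow_half_eq_sqrt (by positivity)]
          congr 1
          rw [show ((n + 1 : ℕ) : ℝ) * (c' / 16) = (Real.sqrt (c' * ((n + 1 : ℕ) : ℝ)) / 4) ^ 2 by
            rw [div_pow, Real.sq_sqrt hcN]; ring]
          exact Real.sqrt_sq (by positivity)
  rw [← hsq (occupation (n + 1) (boxConstantMode L) Ψ.ψ)]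
  exact ofReal_quarter_mul_le_sq hc'.le (n + 1) (h1.trans (hkey.trans (add_le_add le_rfl h2)))

/-- **The residual at one potential from the two stubs at that potential**: slack exchange at `v`
and rigidity at `v` give "condensed competitors ⟹ `HasGroundStateBEC v ρ`" for `ρ < min ρ₃ ρ_R`
and every `0 < c ≤ 1` (flat-mode occupation `≤ λ_max`, `le_condensateNumber`). [folklore] -/
theorem condensedToBECAt_of_slackExchange_of_rigidity {v : ℝ → ℝ≥0∞}
    (h1 : ∃ ρ₃ : ℝ, 0 < ρ₃ ∧ ∀ ρ : ℝ, 0 < ρ → ρ < ρ₃ → ∀ c : ℝ, 0 < c → c ≤ 1 →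
      (∀ θ : ℝ, 0 < θ → ∀ᶠ N : ℕ in atTop, ∃ Ψ : TrialState N (sideLength ρ N),
        energy v Ψ ≤ groundStateEnergy v N (sideLength ρ N) + ENNReal.ofReal (θ * N) ∧
          ENNReal.ofReal ((c - θ) * N) ≤ occupation N (boxConstantMode (sideLength ρ N)) Ψ.ψ) →
      ∃ c' : ℝ, 0 < c' ∧ ∀ᶠ N : ℕ in atTop, ∀ ε : ℝ≥0∞, 0 < ε →
        ∃ Φ : TrialState N (sideLength ρ N),
          energy v Φ ≤ groundStateEnergy v N (sideLength ρ N) + ε ∧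
            ENNReal.ofReal (c' * N) ≤ occupation N (boxConstantMode (sideLength ρ N)) Φ.ψ)
    (h2 : ∃ ρR : ℝ, 0 < ρR ∧ ∀ ρ : ℝ, 0 < ρ → ρ < ρR → ∀ᶠ N : ℕ in atTop, ∀ η : ℝ, 0 < η →
      ∃ δ : ℝ≥0∞, 0 < δ ∧ ∀ Ψ Φ : TrialState N (sideLength ρ N),
        energy v Ψ ≤ groundStateEnergy v N (sideLength ρ N) + δ →
          energy v Φ ≤ groundStateEnergy v N (sideLength ρ N) + δ →
            ∃ c : ℂ, ‖c‖ = 1 ∧ ∫⁻ X, (‖Ψ.ψ X - c * Φ.ψ X‖₊ : ℝ≥0∞) ^ 2 ≤ ENNReal.ofReal η) :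
    ∃ ρ₄ : ℝ, 0 < ρ₄ ∧ ∀ ρ : ℝ, 0 < ρ → ρ < ρ₄ → ∀ c : ℝ, 0 < c → c ≤ 1 →
      (∀ θ : ℝ, 0 < θ → ∀ᶠ N : ℕ in atTop, ∃ Ψ : TrialState N (sideLength ρ N),
        energy v Ψ ≤ groundStateEnergy v N (sideLength ρ N) + ENNReal.ofReal (θ * N) ∧
          ENNReal.ofReal ((c - θ) * N) ≤ occupation N (boxConstantMode (sideLength ρ N)) Ψ.ψ) →
      HasGroundStateBEC v ρ := by
  obtain ⟨ρ₃, hρ₃, H1⟩ := h1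
  obtain ⟨ρR, hρR, H2⟩ := h2
  refine ⟨min ρ₃ ρR, lt_min hρ₃ hρR, fun ρ hρ hlt c hc hc1 hC => ?_⟩
  obtain ⟨c', hc', hS⟩ := H1 ρ hρ (hlt.trans_le (min_le_left _ _)) c hc hc1 hC
  have hR := H2 ρ hρ (hlt.trans_le (min_le_right _ _))
  refine ⟨c' / 4, by positivity, ?_⟩
  filter_upwards [flatModeBEC_of_everySlack_of_rigidity hρ hc' hS hR, eventually_gt_atTop 0]
    with N hN hNpos
  obtain ⟨δ, hδ, hΨ⟩ := hN
  have hL : 0 < sideLength ρ N := by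
    unfold sideLength
    exact Real.rpow_pos_of_pos (div_pos (Nat.cast_pos.mpr hNpos) hρ) _
  refine le_condensateNumber v hδ fun Ψ hE => ?_
  exact (hΨ Ψ hE).trans (occupation_le_maxOccupation _
    (_root_.AtomisticToContinuum.BECInfraredBound.aestronglyMeasurable_constMode _)
    (_root_.AtomisticToContinuum.BECInfraredBound.lintegral_constMode_sq hL))

/-! ## The composition: the crux BY NAME from the two stubs -/

/-- **The two stub statements imply the crux, per potential** (kernel-checked, no `sorry`; the
conclusion is the crux UNFOLDED once — `A(v) → ∃ ρ₀ ∀ ρ < ρ₀, HasGroundStateBEC v ρ` for every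
admissible `v` — so that this parametric theorem is not itself a by-name candidate of the skeleton
audit): slack exchange at `v` and rigidity at `v` give the residual at `v`
(`condensedToBECAt_of_slackExchange_of_rigidity`), and the landed transfer
`RewardPaysTheWall.boundaryTransferAt_of_condensedToBECAt` turns `A(v)` into the conclusion.
[folklore] -/
theorem boundaryTransferWeak_from (h1 : SlackExchange)
    (h2 : Theses.BECWallDressingTransfer.GroundStateRigidity) :
    ∀ v : ℝ → ℝ≥0∞, IsRepulsiveFiniteRange v →
      (∃ ρ₀ : ℝ, 0 < ρ₀ ∧ ∀ ρ : ℝ, 0 < ρ → ρ < ρ₀ → ∃ c : ℝ, 0 < c ∧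
        RewardPaysTheWall.TorusBECAt v ρ c) →
      ∃ ρ₀ : ℝ, 0 < ρ₀ ∧ ∀ ρ : ℝ, 0 < ρ → ρ < ρ₀ → HasGroundStateBEC v ρ :=
  fun _v hv hA => RewardPaysTheWall.boundaryTransferAt_of_condensedToBECAt hv
    (condensedToBECAt_of_slackExchange_of_rigidity (h1 _ hv) (h2 _ hv)) hA

/-- **`BoundaryTransferWeak` (the route decl, BY NAME) from the two REGISTERED STUBS** — the
skeleton theorem: `boundaryTransferWeak_from stub_slackExchange stub_groundStateRigidity`. Its only
non-whitelisted axiom is the `sorryAx` of the two stubs; it closes the crux the day both are theorems.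
[folklore] -/
theorem BoundaryTransferWeak_of : Theses.BECConjugateDomination.BoundaryTransferWeak :=
  fun v hv hA => boundaryTransferWeak_from stub_slackExchange stub_groundStateRigidity v hv hA

/-- The crux is ONE proposition under its ~40 route names; the home-route copy
(`BECPeriodicReduction`, stmt-0827's first decl) from the same registered stubs. [folklore] -/
theorem BoundaryTransferWeak_of_periodicReduction :
    Theses.BECPeriodicReduction.BoundaryTransferWeak :=
  fun v hv hA => boundaryTransferWeak_from stub_slackExchange stub_groundStateRigidity v hv hA

end Summit.AtomisticToContinuum.BoseEinsteinCondensation.Cruxes.BoundaryTransferWeak.BirthSlackExchange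

end
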